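import Mathlib.AlgebraicGeometry.Limits
import Mathlib.AlgebraicGeometry.Morphisms.SurjectiveOnStalks
import Mathlib.Algebra.Field.ULift
import Mathlib.RingTheory.KrullDimension.Field
import Mathlib.RingTheory.KrullDimension.PID
import Mathlib.RingTheory.KrullDimension.Polynomial
import Literature.AlgebraicGeometry.Motives.SubschemeCyclesProofs
import Literature.AlgebraicGeometry.Motives.CyclesPrincipalDivisorProofs
import Literature.AlgebraicGeometry.Motives.SubschemeCyclesFlatPullbackProofs
import HarnessLib

/-!
# The named fact `Literature.AlgebraicGeometry.Motives.flatPullback_mem_ratTrivial` is false: a formal counterexample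

`Literature.AlgebraicGeometry.Motives.SubschemeCycles` records Fulton's Theorem 1.7 (flat
pull-back preserves rational equivalence) as the named fact `Literature.AlgebraicGeometry.Motives.flatPullback_mem_ratTrivial`,
but states it for schemes merely *locally* of finite type over a field `k`, while keeping
Fulton's `Rat_d X` (`Literature.ratTrivial X d`, the subgroup *generated* by the cycles `[div f]`, i.e.
finite sums; Fulton, *Intersection Theory*, §1.3, and §1.1/B.1.1: all schemes are algebraic,
i.e. of finite type over a field). At that generality the statement is false, and this file
proves its negation, `Literature.not_flatPullback_mem_ratTrivial : ¬ flatPullback_mem_ratTrivial`,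
sorry-free. (The corrected, finite-type statement is the named fact
`Literature.AlgebraicGeometry.Motives.flatPullback_mem_ratTrivial_of_finiteType` of `SubschemeCycles`; the Stacks Project,
Tag 02S1, proves the locally-finite-type version only for rational equivalence defined by
*locally finite* families of principal divisors, Tag 02RW, and discusses exactly this issue of
infinite sums in Remark Tag 02RZ and Example Tag 02RY.)

Consequently every statement taking `(h : flatPullback_mem_ratTrivial)` as a hypothesis is
vacuous; such consumers should be re-threaded on `flatPullback_mem_ratTrivial_of_finiteType`
(discharged: `flatPullback_mem_ratTrivial_of_finiteType_holds`,
`Literature.AlgebraicGeometry.Motives.SubschemeCyclesRatFiniteTypeHoldsProofs`). Since the verdict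
clean-up of 2026-08-15 the constant `flatPullback_mem_ratTrivial` is
`@[deprecated flatPullback_mem_ratTrivial_of_finiteType]` and no longer a named fact; the two
theorems below that must name it do so under `set_option linter.deprecated false in`.

## The counterexample

Let `k` be a field, `Y = 𝔸¹_k = Spec k[X]`, `X = ∐_{n ∈ ℕ} 𝔸¹_k` (countably many copies) and
`f : X ⟶ Y` the codiagonal. Then `f` is flat and locally of finite type (both properties are
local on the source and `f` restricts to the identity on each copy), of relative dimension `0`
(`IsEquidimensional f 0`: a specialisation `z ⤳ z'` inside a fibre `f⁻¹(y)` forces `z`, `z'` to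
lie in the same copy, where `f` is injective), and `Y ⟶ Spec k` is of finite type; `X` is
locally of finite type over `k` but not quasi-compact. The `0`-cycle `c = [div X] ∈ Rat_0 Y`
(`X ∈ k(Y)` the coordinate, on the `1`-dimensional subvariety `W = Y`) has coefficient
`ord_{(X)}(X) ≠ 0` at the origin. Since `f` is surjective on stalks, all fibre multiplicities
`ℓ(𝒪_{X_{f x}, x})` are `1` and `f^* c = c ∘ f`, which is nonzero at the origin of *every* copy.
But every generator `[div_W φ]` of `Rat_0 X` is supported on the closed subvariety `W`, which is
irreducible and hence lies in a single copy (the copy index `X → ℕ` is continuous for the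
discrete topology, so constant on irreducible subsets); hence every element of
`ratTrivial X 0` (a finite sum) is supported on finitely many copies, and `f^* c ∉ Rat_0 X`.

## Main results

* `Literature.AlgebraicGeometry.Motives.stalkLength_fiber_asFiber_eq_one_of_surjective`: if `𝒪_{Y, g x} → 𝒪_{X,x}` is surjective
  then `ℓ(𝒪_{X_{g x}, x}) = 1`; `Literature.AlgebraicGeometry.Motives.flatPullback_apply_of_surjectiveOnStalks`: `(g^* c) x = c (g x)`
  for `g` surjective on stalks.
* `Literature.AlgebraicGeometry.Motives.exists_finset_of_mem_ratTrivial`: a continuous map to a discrete space takes finitely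
  many values on the support of an element of `ratTrivial X d`.
* `Literature.FlatPullbackRatCounterexample.*`: the codiagonal `∐_ℕ 𝔸¹_k ⟶ 𝔸¹_k`, the cycle
  `[div X]`, and the verification of all hypotheses of `flatPullback_mem_ratTrivial`.
* `Literature.not_flatPullback_mem_ratTrivial : ¬ flatPullback_mem_ratTrivial`.

## References

* W. Fulton, *Intersection Theory* (2nd ed., 1998), §1.1, §1.3, Theorem 1.7, App. B.1.1, B.2.5.
* The Stacks Project, Tags 02RW (Definition 42.19.1, rational equivalence by locally finite
  families), 02RY, 02RZ (infinite sums of rational equivalences), 02S1 (flat pull-back and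
  rational equivalence).
-/

universe u

open CategoryTheory AlgebraicGeometry Limits Order IsLocalRing TopologicalSpace

namespace Literature.AlgebraicGeometry.Motives

/-! ### Fibre multiplicities of morphisms surjective on stalks -/

section StalkSurjective

variable {X Y : Scheme.{u}}

/-- If the stalk map `𝒪_{Y, g x} → 𝒪_{X, x}` of `g : X ⟶ Y` at `x` is surjective, then the
multiplicity `ℓ(𝒪_{X_{g x}, x})` of the fibre at `x` is `1`: by `𝒪_{X_{g x}, x} ≅ 𝒪_{X,x} / 𝔪_{g x} 𝒪_{X,x}`
(`Literature.AlgebraicGeometry.Motives.nonempty_stalkFiber_ringEquiv_asFiber`, Liu Ch. 4, proof of Thm. 3.36) and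
`𝔪_{g x} 𝒪_{X,x} = 𝔪_x` for a surjective local homomorphism, the local ring of the fibre is the
residue field. [folklore] -/
theorem stalkLength_fiber_asFiber_eq_one_of_surjective (g : X ⟶ Y) (x : X)
    (hg : Function.Surjective (g.stalkMap x).hom) :
    stalkLength (g.fiber (g x)) (g.asFiber x) = 1 := by
  obtain ⟨e⟩ := nonempty_stalkFiber_ringEquiv_asFiber g x
  simp only [stalkLength]
  rw [SubschemeCyclesProofs.length_self_eq_of_ringEquiv e]
  set R := ↑(Y.presheaf.stalk (g x))
  set T := ↑(X.presheaf.stalk x)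
  set φ : R →+* T := (g.stalkMap x).hom
  set I : Ideal T := (maximalIdeal R).map φ with hI
  have hle : I ≤ maximalIdeal T := by
    rw [hI, Ideal.map_le_iff_le_comap]
    intro r hr
    rw [Ideal.mem_comap, mem_maximalIdeal, mem_nonunits_iff, isUnit_map_iff]
    exact hr
  have hImax : I.IsMaximal := by
    rcases Ideal.map_eq_top_or_isMaximal_of_surjective φ hg (maximalIdeal.isMaximal R) with h | h
    · exact absurd (top_le_iff.mp (h ▸ hle : (⊤ : Ideal T) ≤ maximalIdeal T))
        (maximalIdeal.isMaximal T).ne_top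
    · exact h
  haveI : IsSimpleModule T (T ⧸ I) :=
    isSimpleModule_iff_quot_maximal.mpr ⟨I, hImax, ⟨LinearEquiv.refl T _⟩⟩
  rw [← Module.length_eq_of_surjective (S := T) (R := T ⧸ I) (M := T ⧸ I)
    Ideal.Quotient.mk_surjective, Module.length_eq_one]
  rfl

/-- For `g : X ⟶ Y` flat, locally of finite type and surjective on stalks (e.g. an open
immersion, or a codiagonal `∐ Y ⟶ Y`), all fibre multiplicities are `1` and the flat pull-back
of a cycle is the composite of its coefficient function with `g`: `(g^* c) x = c (g x)`. [folklore] -/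
theorem flatPullback_apply_of_surjectiveOnStalks (g : X ⟶ Y) [Flat g] [LocallyOfFiniteType g]
    [SurjectiveOnStalks g] (hf : locallyFinsupp_flatPullbackFun.{u}) (c : AlgebraicCycle Y ℤ)
    (x : X) : flatPullback g hf c x = c (g x) := by
  rw [flatPullback_apply, fundamentalCycleFun_apply,
    stalkLength_fiber_asFiber_eq_one_of_surjective g x (g.stalkMap_surjective x)]
  simp

end StalkSurjective

/-! ### Supports of cycles rationally equivalent to zero (finite sums of principal divisors) -/

section Support

variable {X : Scheme.{u}} {ι : Type*} [TopologicalSpace ι] [DiscreteTopology ι]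

/-- A continuous map `p : X → ι` to a discrete space takes only finitely many values on the
support of an element of `Rat_d X = ratTrivial X d`: such an element is a *finite* sum of
generators `± [div_W φ]` (Fulton, *Intersection Theory*, §1.3), each supported on the closed
subvariety `W`, which is irreducible, so that `p` is constant on it. (This finiteness is what
fails for the locally finite sums allowed by the Stacks Project, Tag 02RW; cf. Tags 02RY, 02RZ.)
[folklore] -/
theorem exists_finset_of_mem_ratTrivial (p : C(X, ι)) {d : ℕ} {c : AlgebraicCycle X ℤ}
    (hc : c ∈ ratTrivial X d) : ∃ s : Finset ι, ∀ x, c x ≠ 0 → p x ∈ s := by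
  classical
  induction hc using AddSubgroup.closure_induction with
  | mem c hc =>
    obtain ⟨-, W, _, φ, -, -, hcW⟩ := hc
    refine ⟨{p W.genericPoint}, fun x hx ↦ ?_⟩
    rw [Finset.mem_singleton]
    have hx' : x ∈ Set.range W.ι.base := by
      by_contra h
      exact hx (by rw [hcW]; exact W.divFun_of_notMem_range φ h)
    have hirr : IsPreirreducible (Set.range W.ι.base) := by
      rw [← Set.image_univ]
      exact ((IrreducibleSpace.isIrreducible_univ W.carrier).image W.ι.base
        W.ι.continuous.continuousOn).isPreirreducible
    have hsub : (p '' Set.range W.ι.base).Subsingleton :=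
      (hirr.isPreconnected.image p p.continuous.continuousOn).subsingleton
    exact hsub ⟨x, hx', rfl⟩ ⟨W.genericPoint, ⟨genericPoint W.carrier, rfl⟩, rfl⟩
  | zero => exact ⟨∅, fun x hx ↦ (hx rfl).elim⟩
  | add a b _ _ ha hb =>
    obtain ⟨s, hs⟩ := ha
    obtain ⟨t, ht⟩ := hb
    refine ⟨s ∪ t, fun x hx ↦ ?_⟩
    rw [Finset.mem_union]
    by_cases h : a x = 0
    · right
      refine ht x ?_
      simpa [h] using hx
    · exact Or.inl (hs x h)
  | neg a _ ha =>
    obtain ⟨s, hs⟩ := ha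
    exact ⟨s, fun x hx ↦ hs x (by simpa using hx)⟩

end Support

/-! ### The counterexample: the codiagonal of countably many affine lines -/

namespace FlatPullbackRatCounterexample

open Polynomial

variable (k : Type u) [Field k]

/-- Countably many copies of the affine line `𝔸¹_k = Spec k[X]`, indexed by `ULift ℕ` (so that
the index type lives in the universe of the schemes). [folklore] -/
noncomputable abbrev copies : ULift.{u} ℕ → Scheme.{u} := fun _ ↦ Spec (CommRingCat.of k[X])

/-- The codiagonal `f : ∐_{n ∈ ℕ} 𝔸¹_k ⟶ 𝔸¹_k`, the identity on each copy. [folklore] -/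
noncomputable def codiag : (∐ copies k) ⟶ Spec (CommRingCat.of k[X]) :=
  Sigma.desc fun _ ↦ 𝟙 _

/-- `f` restricts to the identity on each copy. [folklore] -/
@[simp]
lemma ι_codiag (n : ULift.{u} ℕ) : Sigma.ι (copies k) n ≫ codiag k = 𝟙 _ :=
  Sigma.ι_desc _ _

/-- `f` restricts to the identity on each copy, pointwise. [folklore] -/
@[simp]
lemma codiag_ι_apply (n : ULift.{u} ℕ) (a : Spec (CommRingCat.of k[X])) :
    codiag k (Sigma.ι (copies k) n a) = a := by
  rw [← Scheme.Hom.comp_apply, ι_codiag]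
  rfl

/-- `f` is flat (flatness is local on the source). [folklore] -/
instance : Flat (codiag k) := IsZariskiLocalAtSource.sigmaDesc fun _ ↦ inferInstance

/-- `f` is locally of finite type (local on the source). [folklore] -/
instance : LocallyOfFiniteType (codiag k) :=
  IsZariskiLocalAtSource.sigmaDesc fun _ ↦ inferInstance

/-- `f` is surjective on stalks (local on the source). [folklore] -/
instance : SurjectiveOnStalks (codiag k) :=
  IsZariskiLocalAtSource.sigmaDesc fun _ ↦ inferInstance

/-- The copy index `∐_{n ∈ ℕ} 𝔸¹_k → ℕ`, a continuous map for the discrete topology on `ℕ`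
(through Mathlib's homeomorphism `sigmaMk : (Σ n, 𝔸¹_k) ≃ₜ ∐_n 𝔸¹_k`). [folklore] -/
noncomputable def copyIndex : C(↥(∐ copies k), ULift.{u} ℕ) where
  toFun x := ((sigmaMk (copies k)).symm x).1
  continuous_toFun := by
    refine Continuous.comp ?_ (sigmaMk (copies k)).symm.continuous
    exact continuous_sigma_iff.mpr fun _ ↦ continuous_const

/-- The copy index of a point of the `n`-th copy is `n`. [folklore] -/
@[simp]
lemma copyIndex_ι (n : ULift.{u} ℕ) (a : Spec (CommRingCat.of k[X])) :
    copyIndex k (Sigma.ι (copies k) n a) = n := by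
  simp [copyIndex, ← sigmaMk_mk]

/-- Specialisations in `∐_n 𝔸¹_k` stay inside a copy. [folklore] -/
lemma ι_eq_of_specializes {n m : ULift.{u} ℕ} {a b : Spec (CommRingCat.of k[X])}
    (h : Sigma.ι (copies k) n a ⤳ Sigma.ι (copies k) m b) : n = m := by
  have h' := h.map (copyIndex k).continuous
  rw [copyIndex_ι, copyIndex_ι, specializes_iff_eq] at h'
  exact h'

/-- `f` has relative dimension `0` (`Scheme.Hom.IsEquidimensional f 0`): every point of every
scheme-theoretic fibre `f⁻¹(y)` is minimal (and maximal) for the specialisation order, since a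
specialisation `z ⤳ z'` in the fibre maps to a specialisation in `∐_n 𝔸¹_k` between two points
of the same copy with the same image `y` under `f`, which is injective on each copy. [folklore] -/
theorem isEquidimensional_codiag : (codiag k).IsEquidimensional 0 := by
  intro y z _
  rw [Nat.cast_zero, Order.height_eq_zero]
  intro z' hz'
  suffices h : z' = z from h.ge
  apply ((codiag k).fiberι y).isEmbedding.injective
  have hspec : (codiag k).fiberι y z ⤳ (codiag k).fiberι y z' :=
    (Scheme.le_iff_specializes.mp hz').map ((codiag k).fiberι y).continuous
  have hF : codiag k ((codiag k).fiberι y z) = codiag k ((codiag k).fiberι y z') := by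
    rw [apply_fiberι, apply_fiberι]
  obtain ⟨⟨n, a⟩, hx⟩ := (sigmaMk (copies k)).surjective ((codiag k).fiberι y z)
  obtain ⟨⟨m, b⟩, hx'⟩ := (sigmaMk (copies k)).surjective ((codiag k).fiberι y z')
  rw [sigmaMk_mk] at hx hx'
  rw [← hx, ← hx'] at hspec hF ⊢
  obtain rfl := ι_eq_of_specializes k hspec
  rw [codiag_ι_apply, codiag_ι_apply] at hF
  rw [hF]

/-! #### The affine line: the origin, its codimension, the dimension of `𝔸¹` -/

/-- The origin of `𝔸¹_k`: the closed point `(X) ∈ Spec k[X]`. [folklore] -/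
noncomputable def origin : Spec (CommRingCat.of k[X]) :=
  ⟨Ideal.span {(X : k[X])}, (Ideal.span_singleton_prime X_ne_zero).mpr prime_X⟩

/-- The prime ideal of the origin is `(X)` (by `rfl`). [folklore] -/
lemma origin_asIdeal : (origin k).asIdeal = Ideal.span {(X : k[X])} := rfl

/-- `(X) ⊂ k[X]` is a maximal ideal (a nonzero prime in a principal ideal domain). [folklore] -/
instance : (origin k).asIdeal.IsMaximal :=
  IsPrime.to_maximal_ideal (by
    rw [origin_asIdeal, Ne, Ideal.span_singleton_eq_bot]
    exact X_ne_zero)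

/-- The origin has codimension one in `𝔸¹_k`: `coheight (X) = height (X) = 1` (maximal ideals
of the principal ideal domain `k[X]`, which is not a field, have height one). [folklore] -/
lemma coheight_origin : coheight (origin k) = 1 := by
  rw [← idealHeight_eq_coheight]
  exact IsPrincipalIdealRing.height_eq_one_of_isMaximal _ Ideal.polynomial_not_isField

/-- Codimension-one points of `𝔸¹_k` are closed points: a prime of height one of `k[X]` is
nonzero, hence maximal, so the point is minimal for the specialisation order. [folklore] -/
lemma isMin_of_coheight_eq_one {z : Spec (CommRingCat.of k[X])} (hz : coheight z = 1) :
    IsMin z := by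
  have h1 : z.asIdeal.height = 1 := by rw [idealHeight_eq_coheight]; exact hz
  have hne : z.asIdeal ≠ ⊥ := fun h ↦ by
    rw [h, Ideal.height_bot] at h1
    exact zero_ne_one h1
  haveI : z.asIdeal.IsMaximal := IsPrime.to_maximal_ideal hne
  intro z' hz'
  have hle : z.asIdeal ≤ z'.asIdeal :=
    (PrimeSpectrum.le_iff_specializes z z').mpr (Scheme.le_iff_specializes.mp hz')
  have heq : z = z' := PrimeSpectrum.ext (Ideal.IsMaximal.eq_of_le ‹_› z'.isPrime.ne_top hle)
  exact heq ▸ le_rfl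

/-- `dim 𝔸¹_k = 1`: the generic point of `Spec k[X]` has height `dim k[X] = dim k + 1 = 1` in the
specialisation order (through Mathlib's order isomorphism `Spec R ≃o (PrimeSpectrum R)ᵒᵈ`).
[folklore] -/
lemma height_genericPoint_affineLine :
    height (genericPoint (Spec (CommRingCat.of k[X]))) = 1 := by
  have h1 : height (genericPoint (Spec (CommRingCat.of k[X]))) =
      coheight (⊥ : PrimeSpectrum k[X]) := by
    rw [genericPoint_eq_bot_of_affine,
      ← Order.height_orderIso (specOrderIsoPrimeSpectrum (.of k[X])),
      specOrderIsoPrimeSpectrum_apply, Order.height_toDual]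
  rw [h1]
  have h2 : (coheight (⊥ : PrimeSpectrum k[X]) : WithBot ℕ∞) = 1 := by
    rw [Order.coheight_bot_eq_krullDim, ← ringKrullDim,
      Polynomial.ringKrullDim_of_isNoetherianRing, ringKrullDim_eq_zero_of_field, zero_add]
  exact_mod_cast h2

/-! #### The coordinate function `X` and its order of vanishing at the origin -/

/-- The coordinate `X ∈ k[X] = Γ(𝔸¹_k, 𝒪)` as a global section. [folklore] -/
noncomputable def coord : Γ(Spec (CommRingCat.of k[X]), ⊤) :=
  (Scheme.ΓSpecIso (CommRingCat.of k[X])).inv X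

/-- `X ≠ 0` as a global section. [folklore] -/
lemma coord_ne_zero : coord k ≠ 0 := by
  intro h
  have h' := congrArg (Scheme.ΓSpecIso (CommRingCat.of k[X])).hom h
  rw [coord, Iso.inv_hom_id_apply, map_zero] at h'
  exact X_ne_zero h'

/-- The origin is not in the basic open `D(X)`, i.e. `X ∈ (X)`. [folklore] -/
lemma origin_notMem_basicOpen_coord :
    origin k ∉ (Spec (CommRingCat.of k[X])).basicOpen (coord k) := by
  intro h
  rw [coord, basicOpen_eq_of_affine] at h
  exact (PrimeSpectrum.mem_basicOpen (x := origin k) (f := (X : k[X]))).mp h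
    (Ideal.mem_span_singleton_self X)

/-- `𝔸¹_k` is nonempty (needed to form `Scheme.germToFunctionField ⊤`). [folklore] -/
instance : Nonempty (⊤ : (Spec (CommRingCat.of k[X])).Opens) :=
  ⟨⟨origin k, trivial⟩⟩

/-- The coordinate `X` as a rational function, `X ∈ k(𝔸¹) = k(X)`. [folklore] -/
noncomputable def coordFun : (Spec (CommRingCat.of k[X])).functionField :=
  (Spec (CommRingCat.of k[X])).germToFunctionField ⊤ (coord k)

/-- `X ≠ 0` in `k(X)`. [folklore] -/
lemma coordFun_ne_zero : coordFun k ≠ 0 :=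
  (map_ne_zero_iff _ (Scheme.germToFunctionField_injective _ _)).mpr (coord_ne_zero k)

/-- `ord_0(X) ≠ 0`: the order of vanishing (Mathlib `Scheme.ord`) of the coordinate `X` at the
origin of `𝔸¹_k` is nonzero (it is `1`, but only non-vanishing is needed). With `R = 𝒪_{𝔸¹,0}`
and `r` the germ of `X`, `Scheme.ord X 0 = ℓ_R(R / r R)` (`Ring.ord`), which vanishes only if
`r` is a unit, i.e. only if `0 ∈ D(X)`. [folklore] -/
lemma ord_coordFun_origin_ne_zero : Scheme.ord (coordFun k) (origin k) ≠ 0 := by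
  intro h0
  have hco := coheight_origin k
  haveI : Ring.KrullDimLE 1 ((Spec (CommRingCat.of k[X])).presheaf.stalk (origin k)) :=
    krullDimLE_of_coheight_le hco.le
  have hr0 : (Spec (CommRingCat.of k[X])).presheaf.germ ⊤ (origin k) trivial (coord k) ≠ 0 :=
    (map_ne_zero_iff _ (germ_injective_of_isIntegral _ (U := ⊤) (origin k) trivial)).mpr
      (coord_ne_zero k)
  have hr0' := mem_nonZeroDivisors_of_ne_zero hr0
  obtain ⟨n, hn⟩ := WithTop.ne_top_iff_exists.mp (Ring.ord_ne_top hr0')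
  have hordHom : Scheme.ordHom (origin k) hco (coordFun k) = Multiplicative.ofAdd (n : ℤ) := by
    have e1 : Scheme.ordHom (origin k) hco (coordFun k) =
        Ring.ordFrac ((Spec (CommRingCat.of k[X])).presheaf.stalk (origin k))
          (algebraMap _ (Spec (CommRingCat.of k[X])).functionField
            ((Spec (CommRingCat.of k[X])).presheaf.germ ⊤ (origin k) trivial (coord k))) := by
      rw [Scheme.algebraMap_germ_eq_germToFunctionField]
      rfl
    rw [e1, Ring.ordFrac_eq_ord _ hr0, Ring.ordMonoidWithZeroHom_eq_coe _ hr0' hn.symm]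
  have hord : Scheme.ord (coordFun k) (origin k) = n :=
    (Scheme.ord_eq_iff hco (coordFun_ne_zero k)).mpr hordHom
  rw [h0] at hord
  have hn0 : n = 0 := by exact_mod_cast hord.symm
  subst hn0
  -- `Ring.ord R r = 0`: `R / r R` is trivial, so `r` is a unit and `0 ∈ D(X)`
  have hsub := Module.length_eq_zero_iff.mp (hn.symm.trans Nat.cast_zero)
  have hunit := Ideal.span_singleton_eq_top.mp (Ideal.Quotient.subsingleton_iff.mp hsub)
  exact origin_notMem_basicOpen_coord k ((Scheme.mem_basicOpen_top _ _ _).mpr hunit)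

/-! #### The cycle `[div X] = [0]` on the affine line -/

/-- `𝔸¹_k` as a closed subvariety of itself (`W = Y`, through the identity). [folklore] -/
noncomputable def lineSelf : ClosedSubvariety (Spec (CommRingCat.of k[X])) where
  carrier := Spec (CommRingCat.of k[X])
  ι := 𝟙 _

/-- The carrier `Spec k[X]` of `lineSelf` is locally Noetherian. [folklore] -/
instance : IsLocallyNoetherian (lineSelf k).carrier :=
  inferInstanceAs (IsLocallyNoetherian (Spec (CommRingCat.of k[X])))

/-- The generic point of `W = 𝔸¹_k ⊆ 𝔸¹_k` is the generic point of `𝔸¹_k` (by `rfl`). [folklore] -/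
lemma lineSelf_genericPoint :
    (lineSelf k).genericPoint = genericPoint (Spec (CommRingCat.of k[X])) := rfl

/-- `dim W = 1` for `W = 𝔸¹_k`. [folklore] -/
lemma lineSelf_dim : (lineSelf k).dim = 1 := by
  rw [ClosedSubvariety.dim, lineSelf_genericPoint]
  exact height_genericPoint_affineLine k

/-- The coefficient function of `[div X]` is `z ↦ ord_z(X)` (the subvariety is all of `𝔸¹_k`).
[folklore] -/
lemma lineSelf_divFun_apply (z : Spec (CommRingCat.of k[X])) :
    (lineSelf k).divFun (coordFun k) z = Scheme.ord (coordFun k) z :=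
  (lineSelf k).divFun_ι_base (coordFun k) z

/-- The `0`-cycle `c = [div X]` on `𝔸¹_k` (which is `[0]`), built with the discharged
local-finiteness fact `ClosedSubvariety.locallyFiniteSupport_divFun_holds`. [folklore] -/
noncomputable def originCycle : AlgebraicCycle (Spec (CommRingCat.of k[X])) ℤ :=
  (lineSelf k).div (lineSelf k).locallyFiniteSupport_divFun_holds (coordFun k)

/-- The coefficients of `[div X]` are the orders of vanishing of `X`. [folklore] -/
lemma originCycle_apply (z : Spec (CommRingCat.of k[X])) :
    originCycle k z = Scheme.ord (coordFun k) z :=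
  lineSelf_divFun_apply k z

/-- `[div X]` has a nonzero coefficient at the origin. [folklore] -/
lemma originCycle_origin_ne_zero : originCycle k (origin k) ≠ 0 := by
  rw [originCycle_apply]
  exact ord_coordFun_origin_ne_zero k

/-- `[div X] ∈ Z_0 𝔸¹_k`: its support consists of codimension-one points (Mathlib's `Scheme.ord`
vanishes elsewhere), which are closed points of `𝔸¹_k`. [folklore] -/
lemma originCycle_mem_cyclesOfDim :
    originCycle k ∈ cyclesOfDim (Spec (CommRingCat.of k[X])) 0 := by
  intro z hz
  rw [originCycle_apply] at hz
  have hco : coheight z = 1 := by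
    by_contra h
    exact hz (Scheme.ord_eq_zero_of_coheight_neq_one h _)
  rw [Nat.cast_zero, Order.height_eq_zero]
  exact isMin_of_coheight_eq_one k hco

/-- `[div X] ∈ Rat_0 𝔸¹_k`: it is one of the generators `ratEquivGenerators` (`W = 𝔸¹_k` of
dimension `0 + 1`, `X ≠ 0`). [folklore] -/
theorem originCycle_mem_ratTrivial :
    originCycle k ∈ ratTrivial (Spec (CommRingCat.of k[X])) 0 := by
  refine AddSubgroup.subset_closure ⟨originCycle_mem_cyclesOfDim k, lineSelf k, inferInstance,
    coordFun k, coordFun_ne_zero k, ?_, ?_⟩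
  · rw [lineSelf_dim]
    norm_num
  · ext z
    rw [originCycle_apply, lineSelf_divFun_apply]

/-! #### `f^*[div X]` is not rationally equivalent to zero -/

/-- `f^* c` restricted to the `n`-th copy is `c`: `(f^* c)(ι_n a) = c a`. [folklore] -/
theorem flatPullback_codiag_originCycle_apply (hf : locallyFinsupp_flatPullbackFun.{u})
    (n : ULift.{u} ℕ) (a : Spec (CommRingCat.of k[X])) :
    flatPullback (codiag k) hf (originCycle k) (Sigma.ι (copies k) n a) = originCycle k a := by
  rw [flatPullback_apply_of_surjectiveOnStalks, codiag_ι_apply]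

/-- `f^*[div X] ∉ Rat_d (∐_n 𝔸¹_k)` for every `d`: it has a nonzero coefficient at the origin of
every copy, while an element of `ratTrivial` is supported on finitely many copies
(`exists_finset_of_mem_ratTrivial` for the copy index). [folklore] -/
theorem flatPullback_codiag_originCycle_notMem (hf : locallyFinsupp_flatPullbackFun.{u})
    (d : ℕ) : flatPullback (codiag k) hf (originCycle k) ∉ ratTrivial (∐ copies k) d := by
  intro h
  obtain ⟨s, hs⟩ := exists_finset_of_mem_ratTrivial (copyIndex k) h
  obtain ⟨n, hn⟩ := Infinite.exists_notMem_finset s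
  refine hn ?_
  have h1 := hs (Sigma.ι (copies k) n (origin k)) (by
    rw [flatPullback_codiag_originCycle_apply]
    exact originCycle_origin_ne_zero k)
  rwa [copyIndex_ι] at h1

/-! #### The data as `k`-schemes, and the instance of `flatPullback_mem_ratTrivial` -/

/-- `𝔸¹_k` as a `k`-scheme (`Literature.specOver k k[X]`). [folklore] -/
noncomputable abbrev lineOver : SchemeOver k := specOver k k[X]

/-- `∐_n 𝔸¹_k` as a `k`-scheme, through `f`. [folklore] -/
noncomputable abbrev copiesOver : SchemeOver k := Over.mk (codiag k ≫ (lineOver k).hom)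

/-- The codiagonal `f` as a morphism of `k`-schemes. [folklore] -/
noncomputable def codiagOver : copiesOver k ⟶ lineOver k := Over.homMk (codiag k) rfl

/-- The underlying morphism of `codiagOver` is `codiag` (by `rfl`). [folklore] -/
@[simp]
lemma codiagOver_left : (codiagOver k).left = codiag k := rfl

/-- The underlying scheme of `lineOver` is `Spec k[X]` (by `rfl`). [folklore] -/
lemma lineOver_left : (lineOver k).left = Spec (CommRingCat.of k[X]) := rfl

/-- The underlying scheme of `copiesOver` is `∐_n 𝔸¹_k` (by `rfl`). [folklore] -/
lemma copiesOver_left : (copiesOver k).left = ∐ copies k := rfl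

/-- `(codiagOver k).left = codiag k` is flat (instance transported along `rfl`). [folklore] -/
instance : Flat (codiagOver k).left := inferInstanceAs (Flat (codiag k))

/-- `(codiagOver k).left = codiag k` is locally of finite type. [folklore] -/
instance : LocallyOfFiniteType (codiagOver k).left :=
  inferInstanceAs (LocallyOfFiniteType (codiag k))

/-- `𝔸¹_k ⟶ Spec k` is locally of finite type (`k[X]` is a finitely generated `k`-algebra). [folklore] -/
instance : LocallyOfFiniteType (lineOver k).hom := by
  change LocallyOfFiniteType (Spec.map (CommRingCat.ofHom (algebraMap k k[X])))
  rw [HasRingHomProperty.Spec_iff (P := @LocallyOfFiniteType)]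
  exact RingHom.finiteType_algebraMap.mpr inferInstance

-- the theorem below must name the deprecated (mis-stated) constant `flatPullback_mem_ratTrivial` of `SubschemeCycles`
set_option linter.deprecated false in
/-- The instance of `flatPullback_mem_ratTrivial` at the codiagonal `f : ∐_n 𝔸¹_k ⟶ 𝔸¹_k`
(flat, locally of finite type, of relative dimension `0`, over `𝔸¹_k ⟶ Spec k` of finite type,
with the discharged fact `locallyFinsupp_flatPullbackFun_holds`) and the cycle
`[div X] ∈ Rat_0 𝔸¹_k`: it asserts `f^*[div X] ∈ Rat_0 (∐_n 𝔸¹_k)`. [folklore] -/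
theorem flatPullback_mem_of_flatPullback_mem_ratTrivial (h : flatPullback_mem_ratTrivial.{u}) :
    flatPullback (codiag k) locallyFinsupp_flatPullbackFun_holds (originCycle k) ∈
      ratTrivial (∐ copies k) 0 :=
  h (codiagOver k) locallyFinsupp_flatPullbackFun_holds (e := 0)
    (isEquidimensional_codiag k) (d := 0) (originCycle_mem_ratTrivial k)

end FlatPullbackRatCounterexample

/-! ### The refutation -/

-- the theorem below must name the deprecated (mis-stated) constant `flatPullback_mem_ratTrivial` of `SubschemeCycles`
set_option linter.deprecated false in
/-- **The (deprecated) constant `Literature.AlgebraicGeometry.Motives.flatPullback_mem_ratTrivial` (Fulton, *Intersection Theory*, Thm. 1.7,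
mis-stated for schemes locally of finite type with finitely generated `Rat_d`) is false.**
Counterexample (`Literature.FlatPullbackRatCounterexample`), over the field `k = ULift ℚ` of the
ambient universe: the codiagonal `f : ∐_{n ∈ ℕ} 𝔸¹_k ⟶ 𝔸¹_k` is flat, locally of finite type
and of relative dimension `0`, `𝔸¹_k` is of finite type over `k`, and `[div X] ∈ Rat_0 𝔸¹_k`,
but `f^*[div X] = ∑_n [0_n]` is supported on every copy whereas every element of
`ratTrivial (∐_n 𝔸¹_k) 0` — a finite sum of cycles `[div_W φ]` with `W` irreducible — is
supported on finitely many copies. Fulton's theorem is stated for algebraic schemes (finite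
type over a field, §1.1, B.1.1), where this cannot happen; the corrected named fact is
`Literature.AlgebraicGeometry.Motives.flatPullback_mem_ratTrivial_of_finiteType`. The Stacks Project obtains the statement for
schemes locally of finite type (Tag 02S1) only by defining rational equivalence with locally
finite families (Tag 02RW; Remark 02RZ, Example 02RY). [folklore] -/
theorem not_flatPullback_mem_ratTrivial : ¬ flatPullback_mem_ratTrivial.{u} := fun h ↦
  FlatPullbackRatCounterexample.flatPullback_codiag_originCycle_notMem (ULift.{u} ℚ)
    locallyFinsupp_flatPullbackFun_holds 0
    (FlatPullbackRatCounterexample.flatPullback_mem_of_flatPullback_mem_ratTrivial (ULift.{u} ℚ) h)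

end Literature.AlgebraicGeometry.Motives
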